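import Summits.HodgeConjecture.HodgeConjecture.Theses.AnchorTransport
import Summits.HodgeConjecture.HodgeConjecture.Theorems.AnchorTransportTargetIffHodgeConjecture
import Literature.AlgebraicGeometry.HodgeTheory.GysinFormalismHodgeOfGysin
import Literature.AlgebraicGeometry.HodgeTheory.ComplexConjugation
import Literature.AlgebraicTopology.SingularHomology.SphereLikeCupForm
import Literature.AlgebraicGeometry.Motives.VarietiesProjectiveSpaceProofs
import Literature.AlgebraicGeometry.Motives.ProjectiveSpaceFieldPointsBijective

/-!
# `AnchorExistence` (stmt-HodgeConjecture-1077) · Negative · ceiling and load-bearing hypotheses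

Negative knowledge for the crux `AnchorTransport.AnchorExistence` (route AnchorTransport, rank 3),
from the standing disprover's work file `Cruxes/AnchorExistence/Disproof.lean` (§1–§2):

* CEILING. `HodgeConjecture → AnchorExistence` is landed (constant family,
  `anchorTransport_anchorExistence_of_hodgeConjecture`); contrapositively
  `not_hodgeConjecture_of_not_anchorExistence`: every refutation of the crux refutes the summit, so no
  `_refuted` theorem for this crux exists short of `¬ HodgeConjecture`.
* FORCED HYPOTHESES. In an anchor datum `c = e^*(A|_{𝒳_{s₁}})` with `A|_{𝒳_{s₁}}` rational of type
  `(p,p)`, so `c` is rational (`isRationalClass_of_anchor`) and of type `(p,p)`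
  (`isOfHodgeType_of_anchor`): both hypotheses of the crux on the class are consequences of its
  conclusion.  Hence the crux with `IsRationalClass c` dropped is FALSE outright
  (`anchorExistence_false_without_isRationalClass`; witness `X = ℙ⁰_ℂ`, `p = 0`, `c = i·1`, which is of
  type `(0,0)` in the Hodge model supplied by `nonempty_hodgeModel_holds` but not rational:
  `not_isRationalClass_I_smul_one`, complex conjugation fixes rational classes), and the crux with
  `IsOfHodgeType` dropped is false as soon as one smooth projective variety carries a rational class of
  even degree `2p` not of type `(p,p)` (`anchorExistence_withoutIsOfHodgeType_false_of`; K3 / abelian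
  surfaces, `p = 1` — witness not yet constructed on the tree's carriers).
Refuter seat refuter-cdisprove-stmt-HodgeConjecture-1077-0 (cdisprove cycle 1), 2026-08-16.
-/

noncomputable section

-- The mandated namespace `Summit.<P>.<Sub>.Theorems.…` repeats `HodgeConjecture` (single-conjunct summit).
set_option linter.dupNamespace false

namespace Summit.HodgeConjecture.HodgeConjecture.Theorems.AnchorExistence.Negative.LoadBearing

open CategoryTheory AlgebraicGeometry
open Literature.AlgebraicGeometry Literature.AlgebraicGeometry.Motives
  Literature.AlgebraicGeometry.HodgeTheory Literature.AlgebraicTopology.SingularHomology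
open Summit.HodgeConjecture.HodgeConjecture.Theses.AnchorTransport (AnchorExistence)

/-! ### Ceiling: the crux is implied by the Hodge conjecture -/

/-- **`¬ AnchorExistence → ¬ HodgeConjecture`.** Under HC every rational `(p,p)` class is algebraic
and then anchored by the constant family `X ⟶ Spec ℂ`
(`anchorTransport_anchorExistence_of_hodgeConjecture`); so the crux is refutable only by refuting the
summit statement. [cite: CharlesSchnell2014Notes, Conj. 11.3.1 and Cor. 11.3.6] -/
theorem not_hodgeConjecture_of_not_anchorExistence (h : ¬ AnchorExistence) :
    ¬ _root_.HodgeConjecture :=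
  fun hHC ↦ h (anchorTransport_anchorExistence_of_hodgeConjecture hHC)

/-! ### The hypotheses on the class are forced by the conclusion -/

variable {n p : ℕ} {X 𝒳 S : SchemeOver ℂ}

/-- **An anchored class is rational**: if `e : X ≅ 𝒳_{s₁}` carries the rational fibre restriction
`A|_{𝒳_{s₁}}` to `c`, then `c` is rational (pull-back of a `ℚ`-valued cocycle).
[cite: HatcherAT2002, §3.1 p. 198] -/
theorem isRationalClass_of_anchor (f : 𝒳 ⟶ S) (s₁ : ComplexPoints S) (e : X ≅ fiberOver f s₁)
    (A : complexBetti 𝒳 (2 * p)) {c : complexBetti X (2 * p)}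
    (hA : IsRationalClass (complexBetti.map (fiberι f s₁) (2 * p) A))
    (hAc : complexBetti.map e.hom (2 * p) (complexBetti.map (fiberι f s₁) (2 * p) A) = c) :
    IsRationalClass c := by
  rw [← hAc]
  exact hA.pullback _

/-- **An anchored class is of type `(p,p)`**: Hodge types are transported along the iso
`e : X ≅ 𝒳_{s₁}` (`IsOfHodgeType.map_of_iso`). [cite: VoisinHodgeI2002, §7.1.1] -/
theorem isOfHodgeType_of_anchor (f : 𝒳 ⟶ S) (s₁ : ComplexPoints S) (e : X ≅ fiberOver f s₁)
    (A : complexBetti 𝒳 (2 * p)) {c : complexBetti X (2 * p)}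
    (hA : IsOfHodgeType n (fiberOver f s₁) (2 * p) p p (complexBetti.map (fiberι f s₁) (2 * p) A))
    (hAc : complexBetti.map e.hom (2 * p) (complexBetti.map (fiberι f s₁) (2 * p) A) = c) :
    IsOfHodgeType n X (2 * p) p p c := by
  rw [← hAc]
  exact hA.map_of_iso e

/-- **`i · 1 ∈ H⁰(Y; ℂ)` is not a rational class** on a nonempty space `Y` (universe `0`): rational
classes are fixed by complex conjugation (`IsRationalClass.conjClass_eq`), `conj (i·1) = (-i)·1`, hence
`(i + i)·1 = 0`, and `m·1 = 0 ⇒ m = 0` on a nonempty space (`constClass_eq_zero_iff`).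
[cite: VoisinHodgeI2002, Cor. 6.12] [cite: HatcherAT2002, §3.1 p. 199] -/
theorem not_isRationalClass_I_smul_one (Y : Type) [TopologicalSpace Y] [Nonempty Y] :
    ¬ IsRationalClass (Complex.I • singularCohomology.one ℂ Y) := by
  intro h
  have h1 := h.conjClass_eq
  rw [conjClass_smul, (isRationalClass_one Y).conjClass_eq, Complex.conj_I] at h1
  have h2 : (Complex.I + Complex.I) • singularCohomology.one ℂ Y = 0 := by
    have h3 : Complex.I • singularCohomology.one ℂ Y - (-Complex.I) • singularCohomology.one ℂ Y = 0 :=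
      sub_eq_zero.mpr h1.symm
    rwa [← sub_smul, sub_neg_eq_add] at h3
  have h4 : constClass (R := ℂ) ℂ Y (Complex.I + Complex.I) = 0 := by
    rw [constClass_eq_smul_one]
    exact h2
  rw [constClass_eq_zero_iff] at h4
  exact Complex.I_ne_zero (add_self_eq_zero.mp h4)

/-- `ℙ⁰_ℂ` has a complex point (homogeneous coordinate `[1]`). [cite: Hartshorne1977, II Ex. 2.14] -/
theorem nonempty_complexPoints_projectiveSpace_zero :
    Nonempty (ComplexPoints (projectiveSpace 0 ℂ)) :=
  ⟨ProjectiveSpace.pointOfVec ℂ (fun _ ↦ (1 : ℂ)) (fun h ↦ one_ne_zero (congr_fun h 0))⟩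

/-- **The crux WITHOUT `IsRationalClass c` is false.** The statement below is `AnchorExistence` with the
rationality hypothesis deleted (conclusion verbatim).  Witness: `X = ℙ⁰_ℂ` (smooth projective of
dimension `0`, `isSmoothProjective_projectiveSpace_holds`), `p = 0`, `c = i·1 ∈ H⁰(X(ℂ); ℂ)`: of type
`(0,0)` (`isOfHodgeType_zero_zero_zero` in the Hodge model of `nonempty_hodgeModel_holds`) and not
rational (`not_isRationalClass_I_smul_one`), while any anchor datum would make it rational
(`isRationalClass_of_anchor`).  So rationality is load-bearing — in the cheap sense that the
conclusion forces it. [cite: Deligne2000, §1] -/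
theorem anchorExistence_false_without_isRationalClass :
    ¬ (∀ ⦃n : ℕ⦄ ⦃X : SchemeOver ℂ⦄, IsSmoothProjective n X →
        ∀ (p : ℕ) (c : complexBetti X (2 * p)), IsOfHodgeType n X (2 * p) p p c →
          ∃ (𝒳 S : SchemeOver ℂ) (f : 𝒳 ⟶ S) (s₁ s₀ : ComplexPoints S) (e : X ≅ fiberOver f s₁)
            (A : complexBetti 𝒳 (2 * p)),
            IsSmoothProjectiveFamily f n ∧ IrreducibleSpace S.left ∧ AlgebraicGeometry.Smooth S.hom ∧
            (∀ s : ComplexPoints S, IsRationalClass (complexBetti.map (fiberι f s) (2 * p) A) ∧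
              IsOfHodgeType n (fiberOver f s) (2 * p) p p (complexBetti.map (fiberι f s) (2 * p) A)) ∧
            complexBetti.map e.hom (2 * p) (complexBetti.map (fiberι f s₁) (2 * p) A) = c ∧
            complexBetti.map (fiberι f s₀) (2 * p) A ∈ algebraicClasses (fiberOver f s₀) p) := by
  intro h
  have hX : IsSmoothProjective 0 (projectiveSpace 0 ℂ) := isSmoothProjective_projectiveSpace_holds ℂ 0
  obtain ⟨M⟩ := nonempty_hodgeModel_holds hX
  haveI := nonempty_complexPoints_projectiveSpace_zero
  have hc : IsOfHodgeType 0 (projectiveSpace 0 ℂ) (2 * 0) 0 0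
      (Complex.I • singularCohomology.one ℂ (ComplexPoints (projectiveSpace 0 ℂ))) :=
    isOfHodgeType_zero_zero_zero M _
  obtain ⟨𝒳, S, f, s₁, s₀, e, A, -, -, -, hfib, hAc, -⟩ := h hX 0 _ hc
  exact not_isRationalClass_I_smul_one _ (isRationalClass_of_anchor f s₁ e A (hfib s₁).1 hAc)

/-- **The crux WITHOUT `IsOfHodgeType` is false as soon as some smooth projective variety carries a
rational class of degree `2p` NOT of type `(p,p)`** (a transcendental rational class in `H²` of a K3 or
abelian surface; not yet constructed on the tree's carriers): the anchor datum would transport the type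
`(p,p)` of `A|_{𝒳_{s₁}}` to `c` (`isOfHodgeType_of_anchor`). [cite: VoisinHodgeI2002, §7.1.1 and §11.3] -/
theorem anchorExistence_withoutIsOfHodgeType_false_of
    (hw : ∃ (n : ℕ) (X : SchemeOver ℂ) (p : ℕ) (c : complexBetti X (2 * p)),
      IsSmoothProjective n X ∧ IsRationalClass c ∧ ¬ IsOfHodgeType n X (2 * p) p p c) :
    ¬ (∀ ⦃n : ℕ⦄ ⦃X : SchemeOver ℂ⦄, IsSmoothProjective n X →
        ∀ (p : ℕ) (c : complexBetti X (2 * p)), IsRationalClass c →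
          ∃ (𝒳 S : SchemeOver ℂ) (f : 𝒳 ⟶ S) (s₁ s₀ : ComplexPoints S) (e : X ≅ fiberOver f s₁)
            (A : complexBetti 𝒳 (2 * p)),
            IsSmoothProjectiveFamily f n ∧ IrreducibleSpace S.left ∧ AlgebraicGeometry.Smooth S.hom ∧
            (∀ s : ComplexPoints S, IsRationalClass (complexBetti.map (fiberι f s) (2 * p) A) ∧
              IsOfHodgeType n (fiberOver f s) (2 * p) p p (complexBetti.map (fiberι f s) (2 * p) A)) ∧
            complexBetti.map e.hom (2 * p) (complexBetti.map (fiberι f s₁) (2 * p) A) = c ∧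
            complexBetti.map (fiberι f s₀) (2 * p) A ∈ algebraicClasses (fiberOver f s₀) p) := by
  intro h
  obtain ⟨n, X, p, c, hX, hc, hpp⟩ := hw
  obtain ⟨𝒳, S, f, s₁, s₀, e, A, -, -, -, hfib, hAc, -⟩ := h hX p c hc
  exact hpp (isOfHodgeType_of_anchor f s₁ e A (hfib s₁).2 hAc)

end Summit.HodgeConjecture.HodgeConjecture.Theorems.AnchorExistence.Negative.LoadBearing

end
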